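import Summits.CriticalPhenomena.PercolationContinuityZ3.Theorems.Transplant.CayleyNegCustomersHolds
import Summits.CriticalPhenomena.PercolationContinuityZ3.Theorems.Transplant.CayleyCommutatorWalks
import HarnessLib

/-!
# Connected unit cylinders in CLASS 2 for EVERY unit-range generating set (diagonal and doubled letters allowed): the companion-alphabet trick

builds on p205010 (kernel theorem, internal audit signed; external expert review pending) — through the closed one-type `{±1}` node
(`CayleyNeg₂.theta_eq_zero_of_le`, file `CayleyNegCustomersHolds`) for the unconditional row.  Lane `prim-bschramm`, seat `prim-bschramm-p4` gen 13 (PART C3 of `P4-GENERAL.md` §35.7).  Helper file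
(`--supports stmt-CriticalPhenomena-4575 --as helper`).

So far every connected-unit-cylinder criterion of the lineage asked for LETTERS-TYPE alphabets (each generator in `ker φ ∪ {s₀^{±1}, s₁^{±1}}`:
`boxWalks_of_classThree`, `KerGen.mem_closure_of_eq_zero`, `NilNeg.NegData`); diagonal letters (`φ(s) = (±1, ±1)`) and doubled letters (`φ(s) = ±e_i`,
`s ≠ s_i^{±1}`) were outside.  THEOREM (`CylBase.boxWalks_of_classTwo`): **in a group of nilpotency class ≤ 2, for EVERY finite symmetric generating
`S` and every additive `φ` with `‖φ(S)‖_∞ ≤ 1` and unit steps `s₀, s₁ ∈ S`, every kernel element is joined to `1` inside the unit cylinder** — so `C_1` is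
connected.  Device: the COMPANION ALPHABET `A' = {s₀^{±1}, s₁^{±1}} ∪ {π(s)^{±1} : s ∈ S}`, `π(s) = s·s₁^{−φ₁ s}·s₀^{−φ₀ s} ∈ ker φ` — a letters-type
generating set of the SAME group, to which the kernel criterion applies: `ker φ = ⟨π(S)^{±}, left-normed A'-commutators⟩`; in class 2 only weight 2
survives, and each `⁅a, b⁆` (`a, b ∈ A'`) has a box walk in `Cay(Γ; S)` for ONE sign pattern (toolbox file `CayleyCommutatorWalks`:
`walk_commutator`, `walk_proj`, `compAlph`), the other sign being its INVERSE by centrality (`⁅a⁻¹, b⁆ = ⁅a, b⁆⁻¹`).  CUSTOMERS: `CayleyNeg₂.ofClassTwo` ⟹ **`theta_eq_zero_of_le_classTwo` (UNCONDITIONAL): θ_g(p) = 0 ∀ p ≤ p_c on `Cay(Γ; S)`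
for every class-≤2 group, every unit-range `S` with unit steps and ONE `S`-preserving φ-reversing automorphism** (e.g. `(H₃(ℤ) × ℤ; a, b, a·d)`,
`(H_{2k+1}; any unit-range S)`, `N_{m,2}/K` with reversal-closed unit-range words).  The frames-only twin (`CayleyFrm₂.ofClassTwo`, no
automorphism, modulo N2) is filed separately (`CayleyClassTwoFrm`) behind `CayleySkeletonFrm`.
SHARP IN THE CLASS: for the letters-only free nilpotent group of class THREE `N_{3,3} = ⟨a₁, a₂, a₃⟩` with the doubled chart `φ = (x₁ + x₃, x₂)` (or the
diagonal chart `(x₁ + x₃, x₂ + x₃)`) the unit cylinder is DISCONNECTED (P4-GENERAL §35.7: killing `a₂` leaves the 1-dimensional box automaton of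
`⟨a₁, a₃⟩`, whose loop group `⟨a₃a₁⁻¹, a₃⁻¹a₁⟩` meets `γ₃` in rank 1 < 2; GAP certificate j174868: index 5 resp. 25 in the 5-class-3 quotient, index 1
for the letters-type controls) — so in class 3 the letters-type hypothesis of `boxWalks_of_classThree` cannot be dropped, while the lazy chart
`(x₁, x₂)` of the same graph IS letters-type and connected: from class 3 on, the CHOICE of chart matters.
[cite: BenjaminiSchramm1996, Conj. 4; §2 (Cayley graphs)] [cite: KozmaNitzan2024, §4 p. 16 (Lemma 8)]
-/

noncomputable section

namespace Summit.CriticalPhenomena.PercolationContinuityZ3.Theorems.Transplant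

open SimpleGraph Walk Subgroup Literature.Probability.LatticeModels Literature.Probability.Percolation
open scoped Classical commutatorElement

namespace CayCyl

namespace CylBase

variable {Γ : Type} [Group Γ] {S : Finset Γ} (B : CylBase Γ S)

/-! ## §3 The theorem: box walks for every kernel element in class 2 -/

/-- The set of kernel elements joined to `1` inside the unit cylinder. [folklore] -/
def Good : Set Γ := {g | B.φ g = 0 ∧ ∃ w : (mulCayley (S : Set Γ)).Walk (1 : Γ) g, B.InBox 1 w}

/-- `π(s)` and `π(s)⁻¹` are good, with proj-shaped walks. [folklore] -/
theorem proj_zpow_good {s : Γ} (hs : s ∈ S) (σ : ℤˣ) :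
    B.φ ((B.proj s) ^ (σ : ℤ)) = 0 ∧ ∃ w : (mulCayley (S : Set Γ)).Walk (1 : Γ) ((B.proj s) ^ (σ : ℤ)),
      ∀ z ∈ w.support, B.φ z = 0 ∨ B.φ z = B.φ s ∨ B.φ z = Pi.single 0 (B.φ s 0) := by
  obtain ⟨w, hw⟩ := B.walk_proj hs
  rcases Int.units_eq_one_or σ with rfl | rfl
  · rw [Units.val_one, zpow_one]; exact ⟨B.φ_proj s, w, hw⟩
  · rw [Units.val_neg, Units.val_one, zpow_neg, zpow_one]
    refine ⟨by rw [B.φ_inv, B.φ_proj, neg_zero], ?_⟩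
    obtain ⟨w', hw'⟩ := B.walk_inv w
    refine ⟨w', fun z hz => ?_⟩
    obtain ⟨z', hz', e⟩ := hw' z hz
    rw [B.φ_proj, add_zero] at e
    rw [e]; exact hw z' hz'

/-- **Commutators of good elements are good** (heights unchanged: `φ g = φ h = 0`). [folklore] -/
theorem commutator_good {g h : Γ} (hg : g ∈ B.Good) (hh : h ∈ B.Good) : ⁅g, h⁆ ∈ B.Good := by
  obtain ⟨hg0, wg, hwg⟩ := hg
  obtain ⟨hh0, wh, hwh⟩ := hh
  obtain ⟨w, hw⟩ := B.walk_commutator wg wh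
  refine ⟨KerGen.phi_commutatorElement B.φ B.map_mul g h, w, fun z hz => ?_⟩
  rcases hw z hz with ⟨z', hz', e | e⟩ | ⟨z', hz', e | e⟩
  · rw [e]; exact hwg z' hz'
  · rw [e, hh0, zero_add]; exact hwg z' hz'
  · rw [e, hg0, zero_add]; exact hwh z' hz'
  · rw [e]; exact hwh z' hz'

/-- **A step letter against a proj-shaped kernel element, good sign**: if `t ∈ {s_i^{±1}}` and `φ t + P ⊆ Λ₁` for the proj heights `P` of `k`,
then `⁅t, k⁆` is good. [folklore] -/
theorem step_commutator_good {t k : Γ} (ht : t ∈ S ∨ t⁻¹ ∈ S) (ht1 : t ≠ 1) (hφt : B.φ t ∈ box 2 1) (hk : B.φ k = 0)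
    (wk : (mulCayley (S : Set Γ)).Walk (1 : Γ) k) (hP : ∀ z ∈ wk.support, B.φ z ∈ box 2 1)
    (hPt : ∀ z ∈ wk.support, B.φ t + B.φ z ∈ box 2 1) : ⁅t, k⁆ ∈ B.Good := by
  obtain ⟨wt, hwt⟩ := B.walk_letter ht ht1
  obtain ⟨w, hw⟩ := B.walk_commutator wt wk
  refine ⟨KerGen.phi_commutatorElement B.φ B.map_mul t k, w, fun z hz => ?_⟩
  rcases hw z hz with ⟨z', hz', e | e⟩ | ⟨z', hz', e | e⟩
  · rw [e]; rcases hwt z' hz' with e' | e'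
    · rw [e']; exact zero_mem_box 2 1
    · rw [e']; exact hφt
  · rw [e, hk, zero_add]; rcases hwt z' hz' with e' | e'
    · rw [e']; exact zero_mem_box 2 1
    · rw [e']; exact hφt
  · rw [e]; exact hPt z' hz'
  · rw [e]; exact hP z' hz'

/-- **Both commutators `⁅s₀, k⁆`, `⁅s₀⁻¹, k⁆` lie in the subgroup generated by the good elements** for a proj-shaped kernel element `k`
(class 2: the bad sign is the inverse of the good one). [folklore] -/
theorem step₀_commutator_mem_closure (h2 : (⊤ : Subgroup Γ).lowerCentralSeries 2 = ⊥) {k s : Γ} (hs : s ∈ S) (hk : B.φ k = 0)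
    (wk : (mulCayley (S : Set Γ)).Walk (1 : Γ) k) (hwk : ∀ z ∈ wk.support, B.φ z = 0 ∨ B.φ z = B.φ s ∨ B.φ z = Pi.single 0 (B.φ s 0))
    {t : Γ} (ht : t = B.s₀ ∨ t = B.s₀⁻¹) : ⁅t, k⁆ ∈ Subgroup.closure B.Good := by
  have hs0 : -1 ≤ B.φ s 0 ∧ B.φ s 0 ≤ 1 := by have := B.lip s hs 0; rw [abs_le] at this; exact this
  have hs1 : -1 ≤ B.φ s 1 ∧ B.φ s 1 ≤ 1 := by have := B.lip s hs 1; rw [abs_le] at this; exact this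
  have hP : ∀ z ∈ wk.support, B.φ z ∈ box 2 1 := fun z hz => B.proj_heights_mem_box hs (hwk z hz)
  have hbox_u : B.φ B.s₀ ∈ box 2 1 := by rw [B.φ_s₀, mem_box]; intro j; fin_cases j <;> simp
  have hbox_ui : B.φ B.s₀⁻¹ ∈ box 2 1 := by rw [B.φ_inv, B.φ_s₀, mem_box]; intro j; fin_cases j <;> simp
  -- the good sign: `s₀` if `φ₀ s ≤ 0`, `s₀⁻¹` if `φ₀ s ≥ 0`
  have good_pos : B.φ s 0 ≤ 0 → ⁅B.s₀, k⁆ ∈ B.Good := by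
    intro hle
    refine B.step_commutator_good (Or.inl B.s₀_mem) B.s₀_ne_one hbox_u hk wk hP fun z hz => ?_
    rw [B.φ_s₀, mem_box]
    rcases hwk z hz with e | e | e <;> rw [e] <;> intro j <;> fin_cases j <;> simp <;> omega
  have good_neg : 0 ≤ B.φ s 0 → ⁅B.s₀⁻¹, k⁆ ∈ B.Good := by
    intro hge
    refine B.step_commutator_good (Or.inr (by rw [inv_inv]; exact B.s₀_mem)) (inv_ne_one.2 B.s₀_ne_one) hbox_ui hk wk hP fun z hz => ?_
    rw [B.φ_inv, B.φ_s₀, mem_box]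
    rcases hwk z hz with e | e | e <;> rw [e] <;> intro j <;> fin_cases j <;> simp <;> omega
  rcases ht with rfl | rfl
  · by_cases hle : B.φ s 0 ≤ 0
    · exact Subgroup.subset_closure (good_pos hle)
    · have h := good_neg (by omega)
      have e : ⁅B.s₀, k⁆ = ⁅B.s₀⁻¹, k⁆⁻¹ := by rw [NilTwoSigns.SignData.comm_inv_left h2, inv_inv]
      rw [e]; exact Subgroup.inv_mem _ (Subgroup.subset_closure h)
  · by_cases hge : 0 ≤ B.φ s 0
    · exact Subgroup.subset_closure (good_neg hge)
    · have h := good_pos (by omega)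
      rw [NilTwoSigns.SignData.comm_inv_left h2]; exact Subgroup.inv_mem _ (Subgroup.subset_closure h)

/-- **Both commutators `⁅s₁, k⁆`, `⁅s₁⁻¹, k⁆` lie in the subgroup generated by the good elements** for a proj-shaped kernel element `k`
(class 2). [folklore] -/
theorem step₁_commutator_mem_closure (h2 : (⊤ : Subgroup Γ).lowerCentralSeries 2 = ⊥) {k s : Γ} (hs : s ∈ S) (hk : B.φ k = 0)
    (wk : (mulCayley (S : Set Γ)).Walk (1 : Γ) k) (hwk : ∀ z ∈ wk.support, B.φ z = 0 ∨ B.φ z = B.φ s ∨ B.φ z = Pi.single 0 (B.φ s 0))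
    {t : Γ} (ht : t = B.s₁ ∨ t = B.s₁⁻¹) : ⁅t, k⁆ ∈ Subgroup.closure B.Good := by
  have hs0 : -1 ≤ B.φ s 0 ∧ B.φ s 0 ≤ 1 := by have := B.lip s hs 0; rw [abs_le] at this; exact this
  have hs1 : -1 ≤ B.φ s 1 ∧ B.φ s 1 ≤ 1 := by have := B.lip s hs 1; rw [abs_le] at this; exact this
  have hP : ∀ z ∈ wk.support, B.φ z ∈ box 2 1 := fun z hz => B.proj_heights_mem_box hs (hwk z hz)
  have hbox_u : B.φ B.s₁ ∈ box 2 1 := by rw [B.φ_s₁, mem_box]; intro j; fin_cases j <;> simp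
  have hbox_ui : B.φ B.s₁⁻¹ ∈ box 2 1 := by rw [B.φ_inv, B.φ_s₁, mem_box]; intro j; fin_cases j <;> simp
  have good_pos : B.φ s 1 ≤ 0 → ⁅B.s₁, k⁆ ∈ B.Good := by
    intro hle
    refine B.step_commutator_good (Or.inl B.s₁_mem) B.s₁_ne_one hbox_u hk wk hP fun z hz => ?_
    rw [B.φ_s₁, mem_box]
    rcases hwk z hz with e | e | e <;> rw [e] <;> intro j <;> fin_cases j <;> simp <;> omega
  have good_neg : 0 ≤ B.φ s 1 → ⁅B.s₁⁻¹, k⁆ ∈ B.Good := by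
    intro hge
    refine B.step_commutator_good (Or.inr (by rw [inv_inv]; exact B.s₁_mem)) (inv_ne_one.2 B.s₁_ne_one) hbox_ui hk wk hP fun z hz => ?_
    rw [B.φ_inv, B.φ_s₁, mem_box]
    rcases hwk z hz with e | e | e <;> rw [e] <;> intro j <;> fin_cases j <;> simp <;> omega
  rcases ht with rfl | rfl
  · by_cases hle : B.φ s 1 ≤ 0
    · exact Subgroup.subset_closure (good_pos hle)
    · have h := good_neg (by omega)
      have e : ⁅B.s₁, k⁆ = ⁅B.s₁⁻¹, k⁆⁻¹ := by rw [NilTwoSigns.SignData.comm_inv_left h2, inv_inv]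
      rw [e]; exact Subgroup.inv_mem _ (Subgroup.subset_closure h)
  · by_cases hge : 0 ≤ B.φ s 1
    · exact Subgroup.subset_closure (good_neg hge)
    · have h := good_pos (by omega)
      rw [NilTwoSigns.SignData.comm_inv_left h2]; exact Subgroup.inv_mem _ (Subgroup.subset_closure h)

/-- **Commutators of two step letters are good** (`⁅s_i^{±1}, s_j^{±1}⁆`: a 4-step walk inside the unit box, or trivial). [folklore] -/
theorem step_step_good {t t' : Γ} (ht : t ∈ ({B.s₀, B.s₀⁻¹, B.s₁, B.s₁⁻¹} : Set Γ)) (ht' : t' ∈ ({B.s₀, B.s₀⁻¹, B.s₁, B.s₁⁻¹} : Set Γ)) :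
    ⁅t, t'⁆ ∈ Subgroup.closure B.Good := by
  -- letters, non-triviality and unit-box heights of the four step letters
  have facts : ∀ v ∈ ({B.s₀, B.s₀⁻¹, B.s₁, B.s₁⁻¹} : Set Γ), (v ∈ S ∨ v⁻¹ ∈ S) ∧ v ≠ 1 ∧ B.φ v ∈ box 2 1 := by
    intro v hv
    simp only [Set.mem_insert_iff, Set.mem_singleton_iff] at hv
    rcases hv with rfl | rfl | rfl | rfl
    · exact ⟨Or.inl B.s₀_mem, B.s₀_ne_one, by rw [B.φ_s₀, mem_box]; intro j; fin_cases j <;> simp⟩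
    · exact ⟨Or.inr (by rw [inv_inv]; exact B.s₀_mem), inv_ne_one.2 B.s₀_ne_one,
        by rw [B.φ_inv, B.φ_s₀, mem_box]; intro j; fin_cases j <;> simp⟩
    · exact ⟨Or.inl B.s₁_mem, B.s₁_ne_one, by rw [B.φ_s₁, mem_box]; intro j; fin_cases j <;> simp⟩
    · exact ⟨Or.inr (by rw [inv_inv]; exact B.s₁_mem), inv_ne_one.2 B.s₁_ne_one,
        by rw [B.φ_inv, B.φ_s₁, mem_box]; intro j; fin_cases j <;> simp⟩
  obtain ⟨hta, ht1, hbt⟩ := facts t ht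
  obtain ⟨hta', ht1', hbt'⟩ := facts t' ht'
  by_cases hsum : B.φ t + B.φ t' ∈ box 2 1
  · -- the 4-step commutator walk stays in the unit box
    have hsum' : B.φ t' + B.φ t ∈ box 2 1 := by rwa [add_comm]
    obtain ⟨wt, hwt⟩ := B.walk_letter hta ht1
    obtain ⟨wt', hwt'⟩ := B.walk_letter hta' ht1'
    obtain ⟨w, hw⟩ := B.walk_commutator wt wt'
    refine Subgroup.subset_closure ⟨KerGen.phi_commutatorElement B.φ B.map_mul t t', w, fun z hz => ?_⟩
    rcases hw z hz with ⟨z', hz', e | e⟩ | ⟨z', hz', e | e⟩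
    · rw [e]; rcases hwt z' hz' with e' | e' <;> rw [e']
      exacts [zero_mem_box 2 1, hbt]
    · rw [e]; rcases hwt z' hz' with e' | e' <;> rw [e']
      · rw [add_zero]; exact hbt'
      · exact hsum'
    · rw [e]; rcases hwt' z' hz' with e' | e' <;> rw [e']
      · rw [add_zero]; exact hbt
      · exact hsum
    · rw [e]; rcases hwt' z' hz' with e' | e' <;> rw [e']
      exacts [zero_mem_box 2 1, hbt']
  · -- otherwise the two letters lie on the same axis with the same sign... impossible, or `t' ∈ {t, t⁻¹}`: then the commutator is `1`
    have hs01 : B.φ B.s₀ + B.φ B.s₁ ∈ box 2 1 := by rw [B.φ_s₀, B.φ_s₁, mem_box]; intro j; fin_cases j <;> simp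
    have hs01' : B.φ B.s₀ + B.φ B.s₁⁻¹ ∈ box 2 1 := by rw [B.φ_inv, B.φ_s₀, B.φ_s₁, mem_box]; intro j; fin_cases j <;> simp
    have hs0'1 : B.φ B.s₀⁻¹ + B.φ B.s₁ ∈ box 2 1 := by rw [B.φ_inv, B.φ_s₀, B.φ_s₁, mem_box]; intro j; fin_cases j <;> simp
    have hs0'1' : B.φ B.s₀⁻¹ + B.φ B.s₁⁻¹ ∈ box 2 1 := by rw [B.φ_inv, B.φ_inv, B.φ_s₀, B.φ_s₁, mem_box]; intro j; fin_cases j <;> simp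
    have hs10 : B.φ B.s₁ + B.φ B.s₀ ∈ box 2 1 := by rw [add_comm]; exact hs01
    have hs1'0 : B.φ B.s₁⁻¹ + B.φ B.s₀ ∈ box 2 1 := by rw [add_comm]; exact hs01'
    have hs10' : B.φ B.s₁ + B.φ B.s₀⁻¹ ∈ box 2 1 := by rw [add_comm]; exact hs0'1
    have hs1'0' : B.φ B.s₁⁻¹ + B.φ B.s₀⁻¹ ∈ box 2 1 := by rw [add_comm]; exact hs0'1'
    have h11 : ∀ a : Γ, ⁅a, a⁆ = 1 := fun a => by rw [commutatorElement_def, mul_inv_cancel_right, mul_inv_cancel]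
    have h1i : ∀ a : Γ, ⁅a, a⁻¹⁆ = 1 := fun a => by rw [commutatorElement_def, mul_inv_cancel, one_mul, inv_inv, inv_mul_cancel]
    have hi1 : ∀ a : Γ, ⁅a⁻¹, a⁆ = 1 := fun a => by rw [commutatorElement_def, inv_inv, inv_mul_cancel, one_mul, mul_inv_cancel]
    simp only [Set.mem_insert_iff, Set.mem_singleton_iff] at ht ht'
    rcases ht with rfl | rfl | rfl | rfl <;> rcases ht' with rfl | rfl | rfl | rfl <;>
      first
      | exact absurd hs01 hsum | exact absurd hs01' hsum | exact absurd hs0'1 hsum | exact absurd hs0'1' hsum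
      | exact absurd hs10 hsum | exact absurd hs1'0 hsum | exact absurd hs10' hsum | exact absurd hs1'0' hsum
      | (rw [h11]; exact Subgroup.one_mem _) | (rw [h1i]; exact Subgroup.one_mem _) | (rw [hi1]; exact Subgroup.one_mem _)

/-- **THEOREM (class 2, EVERY unit-range alphabet): every kernel element is joined to `1` inside the unit cylinder `‖φ‖_∞ ≤ 1` of `Cay(Γ; S)`**
— `Γ` of nilpotency class `≤ 2`, `S` finite symmetric generating, `φ` additive with `‖φ(S)‖_∞ ≤ 1` and unit steps `s₀, s₁ ∈ S` (diagonal and doubled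
letters allowed).  Hence `C_1` is connected. [folklore] -/
theorem boxWalks_of_classTwo (h2 : (⊤ : Subgroup Γ).lowerCentralSeries 2 = ⊥) (hS : Subgroup.closure (S : Set Γ) = ⊤)
    (hsymm : ∀ s ∈ S, s⁻¹ ∈ S) (k : Γ) (hk : B.φ k = 0) : ∃ w : (mulCayley (S : Set Γ)).Walk (1 : Γ) k, B.InBox 1 w := by
  have _ := hsymm
  -- the kernel criterion for the companion alphabet
  have hmem := KerGen.mem_closure_of_eq_zero (A := B.compAlph) B.φ B.map_mul (B.closure_compAlph hS) B.compAlph_symm B.φ_s₀ B.φ_s₁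
    B.compAlph_letters hk
  -- it suffices that the generators lie in the closure of the good set
  suffices hsub : ({a | a ∈ B.compAlph ∧ B.φ a = 0} ∪ KerGen.T B.compAlph : Set Γ) ⊆ (Subgroup.closure B.Good : Set Γ) by
    have hk' : k ∈ Subgroup.closure B.Good := (Subgroup.closure_le _).2 hsub hmem
    exact (B.exists_inBox_of_mem_closure 1 (T := B.Good) (fun t ht => ht) hk').2
  -- proj-shaped good elements
  have projGood : ∀ s ∈ S, ∀ σ : ℤˣ, (B.proj s) ^ (σ : ℤ) ∈ B.Good := fun s hs σ => by
    obtain ⟨h0, w, hw⟩ := B.proj_zpow_good hs σ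
    exact ⟨h0, w, fun z hz => B.proj_heights_mem_box hs (hw z hz)⟩
  -- classification of companion letters: step letter or `π(s)^{±1}`
  have cases : ∀ a ∈ B.compAlph, a ∈ ({B.s₀, B.s₀⁻¹, B.s₁, B.s₁⁻¹} : Set Γ) ∨ ∃ s ∈ S, ∃ σ : ℤˣ, a = (B.proj s) ^ (σ : ℤ) := by
    rintro a (ha | ⟨s, hs, rfl⟩ | ⟨s, hs, rfl⟩)
    · exact Or.inl ha
    · exact Or.inr ⟨s, hs, 1, by simp⟩
    · exact Or.inr ⟨s, hs, -1, by simp⟩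
  have stepCases : ∀ t ∈ ({B.s₀, B.s₀⁻¹, B.s₁, B.s₁⁻¹} : Set Γ), (t = B.s₀ ∨ t = B.s₀⁻¹) ∨ (t = B.s₁ ∨ t = B.s₁⁻¹) := by
    intro t ht
    simp only [Set.mem_insert_iff, Set.mem_singleton_iff] at ht
    rcases ht with rfl | rfl | rfl | rfl
    · exact Or.inl (Or.inl rfl)
    · exact Or.inl (Or.inr rfl)
    · exact Or.inr (Or.inl rfl)
    · exact Or.inr (Or.inr rfl)
  -- weight-2 commutators of companion letters lie in the closure of the good set
  have weight2 : ∀ a ∈ B.compAlph, ∀ b ∈ B.compAlph, ⁅a, b⁆ ∈ Subgroup.closure B.Good := by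
    intro a ha b hb
    rcases cases a ha with ha' | ⟨s, hs, σ, rfl⟩ <;> rcases cases b hb with hb' | ⟨s', hs', τ, rfl⟩
    · exact B.step_step_good ha' hb'
    · obtain ⟨h0, w, hw⟩ := B.proj_zpow_good hs' τ
      rcases stepCases a ha' with hi | hi
      · exact B.step₀_commutator_mem_closure h2 hs' h0 w hw hi
      · exact B.step₁_commutator_mem_closure h2 hs' h0 w hw hi
    · obtain ⟨h0, w, hw⟩ := B.proj_zpow_good hs σ
      rw [← commutatorElement_inv]
      rcases stepCases b hb' with hi | hi
      · exact Subgroup.inv_mem _ (B.step₀_commutator_mem_closure h2 hs h0 w hw hi)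
      · exact Subgroup.inv_mem _ (B.step₁_commutator_mem_closure h2 hs h0 w hw hi)
    · exact Subgroup.subset_closure (B.commutator_good (projGood s hs σ) (projGood s' hs' τ))
  rintro a (⟨ha, ha0⟩ | ha)
  · -- kernel letters of the companion alphabet are `π(s)^{±1}` (the step letters have non-zero height)
    rcases cases a ha with ha' | ⟨s, hs, σ, rfl⟩
    · exfalso
      simp only [Set.mem_insert_iff, Set.mem_singleton_iff] at ha'
      rcases ha' with rfl | rfl | rfl | rfl
      · have h := congrFun B.φ_s₀ 0; rw [ha0] at h; simp at h
      · rw [B.φ_inv, neg_eq_zero] at ha0; have h := congrFun B.φ_s₀ 0; rw [ha0] at h; simp at h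
      · have h := congrFun B.φ_s₁ 1; rw [ha0] at h; simp at h
      · rw [B.φ_inv, neg_eq_zero] at ha0; have h := congrFun B.φ_s₁ 1; rw [ha0] at h; simp at h
    · exact Subgroup.subset_closure (projGood s hs σ)
  · -- left-normed commutators: weight 2 by `weight2`, weight ≥ 3 trivial in class 2
    obtain ⟨j, hj⟩ := Set.mem_iUnion.1 ha
    rcases j with _ | j
    · obtain ⟨a', ha', b', hb', rfl⟩ := hj
      exact weight2 a' ha' b' hb'
    · have h1 : a = 1 := KerGen.W_eq_one_of_lowerCentralSeries_eq_bot h2 (by omega) hj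
      rw [h1]; exact Subgroup.one_mem _

end CylBase

end CayCyl

/-! ## §4 Customers -/

section Customers

open CayCyl

variable {Γ : Type} [Group Γ] {S : Finset Γ}

/-- **`CayleyNeg₂` IN CLASS 2 FROM ANY UNIT-RANGE ALPHABET**: additive unit-range `φ` with unit steps, `S` symmetric generating, ONE `S`-preserving
automorphism `ν` with `φν = −φ`; `C_1` connected by `boxWalks_of_classTwo`. [cite: KozmaNitzan2024, §4 p. 16 (Lemma 8)] -/
def CayleyNeg₂.ofClassTwo (h2 : (⊤ : Subgroup Γ).lowerCentralSeries 2 = ⊥) (φ : Γ → Site 2) (map_mul : ∀ g h : Γ, φ (g * h) = φ g + φ h)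
    (lip : ∀ s ∈ S, ∀ i : Fin 2, |φ s i| ≤ 1) (step : ∀ i : Fin 2, ∃ s ∈ S, φ s = Pi.single i 1) (symm : ∀ s ∈ S, s⁻¹ ∈ S)
    (hS : Subgroup.closure (S : Set Γ) = ⊤) (ν : Γ ≃* Γ) (ν_mem : ∀ s, ν s ∈ S ↔ s ∈ S) (ν_φ : ∀ g, φ (ν g) = -φ g) : CayleyNeg₂ Γ S :=
  let B : CylBase Γ S :=
    { φ := φ, map_mul := map_mul, lip := lip
      s₀ := Classical.choose (step 0), s₀_mem := (Classical.choose_spec (step 0)).1, φ_s₀ := (Classical.choose_spec (step 0)).2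
      s₁ := Classical.choose (step 1), s₁_mem := (Classical.choose_spec (step 1)).1, φ_s₁ := (Classical.choose_spec (step 1)).2 }
  { φ := φ, map_mul := map_mul, lip := lip, step := step, ν := ν, ν_mem := ν_mem, ν_φ := ν_φ
    cyl_one := (B.toCylData₂ 1 (B.boxWalks_of_classTwo h2 hS symm)).cylG_connected_of_boxWalks (B.boxWalks_of_classTwo h2 hS symm) le_rfl }

/-- **THEOREM (UNCONDITIONAL; class 2, ANY unit-range alphabet, one sign): `θ_g(p) = 0` for every `p ≤ p_c` at every vertex of `Cay(Γ; S)`** for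
every group of nilpotency class `≤ 2`, every finite symmetric generating `S` admitting an additive `φ : Γ → ℤ²` with `‖φ(S)‖_∞ ≤ 1` and unit steps in
`S`, and ONE `S`-preserving automorphism reversing `φ` — diagonal and doubled letters allowed (e.g. `(H₃(ℤ) × ℤ; a, b, a·d)`, `H_{2k+1}` with any
unit-range system closed under an abelianisation-reversing automorphism).  Via the closed one-type `{±1}` node.
builds on p205010 (kernel theorem, internal audit signed; external expert review pending). [cite: BenjaminiSchramm1996, Conj. 4; §2] -/
theorem theta_eq_zero_of_le_classTwo (h2 : (⊤ : Subgroup Γ).lowerCentralSeries 2 = ⊥) (φ : Γ → Site 2)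
    (map_mul : ∀ g h : Γ, φ (g * h) = φ g + φ h) (lip : ∀ s ∈ S, ∀ i : Fin 2, |φ s i| ≤ 1) (step : ∀ i : Fin 2, ∃ s ∈ S, φ s = Pi.single i 1)
    (symm : ∀ s ∈ S, s⁻¹ ∈ S) (hS : Subgroup.closure (S : Set Γ) = ⊤) (ν : Γ ≃* Γ) (ν_mem : ∀ s, ν s ∈ S ↔ s ∈ S)
    (ν_φ : ∀ g, φ (ν g) = -φ g) (g : Γ) {p : unitInterval} (hp : (p : ℝ) ≤ criticalProb (mulCayley (↑S : Set Γ)) g) :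
    theta (mulCayley (↑S : Set Γ)) g p = 0 :=
  (CayleyNeg₂.ofClassTwo h2 φ map_mul lip step symm hS ν ν_mem ν_φ).theta_eq_zero_of_le g hp

end Customers

end Summit.CriticalPhenomena.PercolationContinuityZ3.Theorems.Transplant

end
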